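import Summits.FinalStateConjecture.FinalStateConjecture.Theorems.ZeroEnergyKerrOrBombStationaryLimitReductionKerrSchildRecut
import Summits.FinalStateConjecture.FinalStateConjecture.Theorems.ZeroEnergyKerrOrBombStationaryLimitReductionNearZoneTransfer
import Summits.FinalStateConjecture.FinalStateConjecture.Theorems.ZeroEnergyKerrOrBombStationaryLimitReductionChartTransferKit
import Summits.FinalStateConjecture.FinalStateConjecture.Theorems.ZeroEnergyKerrOrBombSymplecticDualOfTheBombSig
import HarnessLib

/-!
# Route ZeroEnergyKerrOrBomb · crux `StationaryLimitReduction` (stmt-FinalStateConjecture-10021), line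
# `symplectic-dual-of-the-bomb` (reshape r3) — stub `stub_chartTransfer` (the analytic/bookkeeping half
# `F_an` of the chart transfer), CLOSED

Registered stub `theorem stub_chartTransfer : Sig.stub_chartTransfer` of the checked skeleton
`Cruxes/StationaryLimitReduction/Lines/symplectic_dual_of_the_bomb.lean` (lead
prover-line-stmt-FinalStateConjecture-10021-a1-0, wave 2, 2026-08-16): given a `C²` stationary final-state
decomposition `d` of `O`, Kerr identifications `Θᵢ` of its holes with asymptotic control (`IsKerrChartedWith`)
and the causal covering clauses of the naive Kerr–Schild recut (`KerrSchildRecutCovering`: a late time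
`τ₀' ≥ τ₀`, growing radii `R'ᵢ → ∞` with `C²` convergence of the recut charts on the growing truncated slabs,
and clause (ii) for every `τ₁ > τ₀'`), the summit's Kerr–Schild `FinalStateDecomposition d'` of
`O' = exteriorOf 𝒟 d'.charted`, sub-extremal, with `HasExhaustiveCharts d'`.

`d'` is the recut decomposition (`recutDecomposition`, `…KerrSchildRecut.lean`) at a late time `τ₁ > τ₀'`
chosen so late that the bounded tilt (`kerrChartedWith_tilt_bound`) gives `cᵢ τ₁ − Lᵢ ≥ τ₀`, i.e. every
recut late region lies in the old late region. Then (§4) the recut hole charts `ψᵢ ∘ recutMap Θᵢ` are late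
charts (`isLateChart_recut`: `recutMap Θᵢ` is an open embedding of the boosted exterior by the isometry
clause and the inverse function theorem, `isOpenEmbedding_restrict_of_isometry`; the image clause into
`O'` is `subset_exteriorOf_of_isOpen`), their near zones separate (`separation_recut`, from
`conj_image_truncLateRegion_subset` and the old separation); (§5) the flat chart is re-based at `τ₁`,
near-zone convergence for EVERY radius follows from the growing-radii clause (`R'ᵢ → ∞`,
`tendsto_truncDeviationCk_of_tendsto_atTop`), the flat-domain clause is `excision_transfer`, and both
covering clauses of `d'` (`diff_subset_causalPast` at `τ₁`, exhaustiveness (ii) after `τ₁`) are the given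
clause (ii) read through `charted/certifiedLate/certifiedSlab_recutDecomposition` and `exteriorOf_mono`
(`recutCharted` shrinks with the late time; `O' := exteriorOf 𝒟 (recutCharted d M a Θ τ₁)`). The
hypotheses `HasExhaustiveDocCharts d`, `IsHorizonNormalised d` and hole regularity are not used by this
half (they feed the causal half `stub_recutCovering`). §4 reads `conj_isOpenEmbedding`,
`isLateChart_conj`, `separation_transfer` of `…StationaryLimitReductionNearZoneTransfer.lean` (p113031) in
the `recutMap` vocabulary.
No named fact, nothing restated. References: Dafermos–Luk arXiv:1710.01722, §1.2.1, Conjecture 1.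
-/

-- every `Summit.FinalStateConjecture.FinalStateConjecture.…` name repeats the summit = sub-problem segment (D-0017 layout)
set_option linter.dupNamespace false

noncomputable section

open scoped Topology ENNReal Manifold ContDiff
open Set Filter Function

namespace Summit.FinalStateConjecture.FinalStateConjecture.Theorems.SymplecticDualOfTheBomb

open Literature.Geometry.Lorentzian

/-! ## §4 The recut charts are late charts (given the tilt) and their near zones separate -/

section RecutCharts

variable {𝓢 : Spacetime.{0} 4}

/-- **The recut hole chart is a late chart after `τ₀'`**, given the TILT inclusion `t* > τ₀' ⇒ (Θ u)⁰ > τ₀`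
on the Kerr exterior (supplied by `kerrChartedWith_tilt_bound` for `τ₀'` late enough) and the image clause
(`isLateChart_conj` of `…NearZoneTransfer.lean`, read in the `recutMap` vocabulary). [folklore] -/
theorem isLateChart_recut {𝓑 : StationaryAFBlackHole.{0}} (A : 𝓑.AdaptedChart)
    (Λ : lorentzGroup) (c₀ : E4) {M a r₀ : ℝ} {Θ : E4 → E4} {O O' : Set 𝓢.carrier} {τ₀ τ₀' : ℝ}
    {ψ : (A.background.boost Λ c₀).domain → 𝓢.carrier}
    (hψ : 𝓢.IsLateChart (A.background.boost Λ c₀) O τ₀ ψ) (hr₀ : r₀ ≤ Kerr.rPlus M a)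
    (hΘs : ContDiffOn ℝ ∞ Θ (Kerr.region a r₀ : Set E4)) (hinj : InjOn Θ (Kerr.region a r₀ : Set E4))
    (hiso : ∀ z ∈ (Kerr.exterior M a : Set E4), ∀ v w : E4,
      A.bilin (Θ z) (fderiv ℝ Θ z v) (fderiv ℝ Θ z w) = Kerr.bilin M a z v w)
    (hmaps : MapsTo (recutMap Λ c₀ Θ)
      ((boostedKerrBackground Λ c₀ M a).domain : Set E4) ((A.background.boost Λ c₀).domain : Set E4))
    (htilt : ∀ u ∈ (Kerr.exterior M a : Set E4), τ₀' < u 0 → τ₀ < Θ u 0)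
    (himg : (fun y : (boostedKerrBackground Λ c₀ M a).domain ↦ ψ ⟨recutMap Λ c₀ Θ y.1, hmaps y.2⟩) ''
        (boostedKerrBackground Λ c₀ M a).lateRegion τ₀' ⊆ O') :
    𝓢.IsLateChart (boostedKerrBackground Λ c₀ M a) O' τ₀'
      (fun y ↦ ψ ⟨recutMap Λ c₀ Θ y.1, hmaps y.2⟩) :=
  isLateChart_conj 𝓢 A Λ c₀ hψ hr₀ hΘs hinj hiso hmaps (fun x hx h ↦ by
    rw [poincareInv_apply_add]
    exact htilt _ (mem_boostedKerrExterior.1 hx) h) himg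

variable {O : Set 𝓢.carrier} {k : ℕ}

/-- **The near zones of the recut charts separate** (`separation_transfer` of `…NearZoneTransfer.lean`,
read through `recutImage_image_val`). [folklore] -/
theorem separation_recut (d : StationaryFinalStateDecomposition 𝓢 O k) (M a c r₀ : Fin d.N → ℝ)
    (Θ : Fin d.N → E4 → E4)
    (hmaps : ∀ i, MapsTo (recutMap (d.motion i).1 (d.motion i).2 (Θ i))
      ((recutBackground d M a i).domain : Set E4) ((d.background i).domain : Set E4))
    (hsub : ∀ i, Kerr.IsSubextremal (M i) (a i)) (hc : ∀ i, 0 < c i)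
    (hr₀ : ∀ i, r₀ i < Kerr.rPlus (M i) (a i))
    (hΘc : ∀ i, ContinuousOn (Θ i) (Kerr.region (a i) (r₀ i) : Set E4))
    (hΘm : ∀ i, MapsTo (Θ i) (Kerr.region (a i) (r₀ i) : Set E4) ((d.adapted i).domain : Set E4))
    (hΘe : ∀ i, ∀ x ∈ (Kerr.region (a i) (r₀ i) : Set E4), ∀ s : ℝ,
      Θ i (x + s • E4.basisVector 0) = Θ i x + (c i * s) • E4.basisVector 0)
    (R : ℝ) :
    ∃ τ₁ : ℝ, Pairwise (Function.onFun Disjoint fun i ↦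
      recutChart d M a Θ hmaps i '' (recutBackground d M a i).truncLateRegion τ₁ R) := by
  obtain ⟨τ₁, h⟩ := separation_transfer d M a c r₀ Θ hsub hc hr₀ hΘc hΘm hΘe R
  refine ⟨τ₁, fun i j hij ↦ ?_⟩
  have hij' := h hij
  simp only [Function.onFun] at hij' ⊢
  rw [← recutImage_image_val d M a Θ hmaps i, ← recutImage_image_val d M a Θ hmaps j]
  exact hij'

end RecutCharts

/-! ## §5 The stub: `stub_chartTransfer` -/

/-- **Stub `stub_chartTransfer` (r3, the analytic/bookkeeping half `F_an` of the chart transfer).**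
Given the stationary decomposition `d`, Kerr identifications `Θᵢ` with asymptotic control and the causal
covering clauses of the naive recut (`KerrSchildRecutCovering`, with late time `τ₀'` and growing radii
`R'ᵢ → ∞`), the summit's Kerr–Schild decomposition is the RECUT DECOMPOSITION at a late time
`τ₁ > τ₀'` chosen so late that the bounded tilt (`kerrChartedWith_tilt_bound`) puts every recut late
region inside the old late region (`cᵢ τ₁ − Lᵢ ≥ τ₀`): its hole charts are late charts
(`isLateChart_recut`; image clause by `subset_exteriorOf_of_isOpen`), the flat chart is re-based
(`isLateChart_rebase`), near-zone convergence for every radius follows from the growing-radii clause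
(`tendsto_truncDeviationCk_of_tendsto_atTop`), separation is `separation_recut`, the flat-domain clause is
`excision_transfer`, and BOTH covering clauses of the target (`diff_subset_causalPast` at `τ₁` and
exhaustiveness (ii) after `τ₁`) are the given clause (ii), read through the set identities
`charted/certifiedLate/certifiedSlab_recutDecomposition` and `exteriorOf_mono` (`recutCharted` shrinks in
the late time). [cite: DafermosLuk2017, Conjecture 1] -/
theorem stub_chartTransfer : Sig.stub_chartTransfer := by
  intro X _ _ _ _ _ _ D 𝒟 O d M a c r₀ Θ hO _hex _hnorm _hreg hK hG
  -- the clauses of `IsKerrChartedWith`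
  have hsub := fun i ↦ (hK i).1
  have hc := fun i ↦ (hK i).2.1
  have hr₀ := fun i ↦ (hK i).2.2.2.1
  have hΘs := fun i ↦ (hK i).2.2.2.2.1
  have hinj := fun i ↦ (hK i).2.2.2.2.2.1
  have hΘm := fun i ↦ (hK i).2.2.2.2.2.2.1
  have hΘe := fun i ↦ (hK i).2.2.2.2.2.2.2.1
  have hiso := fun i ↦ (hK i).2.2.2.2.2.2.2.2.1
  have hsubreg : ∀ i, (Kerr.exterior (M i) (a i) : Set E4) ⊆ (Kerr.region (a i) (r₀ i) : Set E4) :=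
    fun i z hz ↦ Kerr.mem_region.2 ((max_le_max (hr₀ i).le le_rfl).trans_lt (Kerr.mem_exterior.1 hz))
  -- the recut maps carry the boosted exteriors into the moved adapted domains
  have hmaps : ∀ i, MapsTo (recutMap (d.motion i).1 (d.motion i).2 (Θ i))
      ((recutBackground d M a i).domain : Set E4) ((d.background i).domain : Set E4) := fun i x hx ↦
    mapsTo_conj (d.motion i).1 (d.motion i).2 (hΘm i) (hsubreg i (mem_boostedKerrExterior.1 hx))
  obtain ⟨τ₀', R', hτ₀', hR', hconv, -, hii⟩ := hG hmaps
  -- tilt bounds and the new late time `τ₁`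
  choose L hL using fun i ↦ kerrChartedWith_tilt_bound _ _ _ _ _ _ _ (hK i)
  obtain ⟨T, hT⟩ := Finite.exists_le fun i ↦ (d.toOver.τ₀ + L i) / c i
  obtain ⟨τ₁, hτ₀'τ₁, hTτ₁⟩ : ∃ τ₁ : ℝ, τ₀' < τ₁ ∧ T ≤ τ₁ :=
    ⟨max (τ₀' + 1) T, (lt_add_one _).trans_le (le_max_left _ _), le_max_right _ _⟩
  have hτ₀τ₁ : d.toOver.τ₀ ≤ τ₁ := hτ₀'.trans hτ₀'τ₁.le
  have htilt : ∀ i, ∀ u ∈ (Kerr.exterior (M i) (a i) : Set E4), τ₁ < u 0 → d.toOver.τ₀ < Θ i u 0 := by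
    intro i u hu hu0
    have h1 := (abs_le.1 (hL i u hu)).1
    have h2 : (d.toOver.τ₀ + L i) / c i ≤ τ₁ := (hT i).trans hTτ₁
    rw [div_le_iff₀ (hc i)] at h2
    nlinarith [mul_lt_mul_of_pos_left hu0 (hc i)]
  -- the hole charts: late charts into `O`, then into `O'`
  have himgO : ∀ i, recutChart d M a Θ hmaps i '' (recutBackground d M a i).lateRegion τ₁ ⊆ O := by
    rintro i _ ⟨y, hy, rfl⟩
    refine (d.toOver.isLateChart i).image_subset ⟨⟨_, hmaps i y.2⟩, ?_, rfl⟩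
    show d.toOver.τ₀ < (poincareInv (d.motion i).1 (d.motion i).2
      (((d.motion i).1 : E4 ≃L[ℝ] E4) (Θ i (poincareInv (d.motion i).1 (d.motion i).2 y.1)) + (d.motion i).2)) 0
    rw [poincareInv_apply_add]
    exact htilt i _ (mem_boostedKerrExterior.1 y.2) hy
  have hlateO : ∀ i, 𝒟.toSpacetime.IsLateChart (recutBackground d M a i) O τ₁ (recutChart d M a Θ hmaps i) :=
    fun i ↦ isLateChart_recut (d.adapted i) (d.motion i).1 (d.motion i).2 (d.toOver.isLateChart i)
      (hr₀ i).le (hΘs i) (hinj i) (hiso i) (hmaps i) (htilt i) (himgO i)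
  have hlate : ∀ i, 𝒟.toSpacetime.IsLateChart (recutBackground d M a i)
      (Summit.FinalStateConjecture.exteriorOf 𝒟.toCauchyDevelopment (recutCharted d M a Θ τ₁)) τ₁
      (recutChart d M a Θ hmaps i) := fun i ↦
    ⟨(hlateO i).contMDiff, (hlateO i).isOpenEmbedding,
      subset_exteriorOf_of_isOpen _ ((himgO i).trans hO.subset) (isOpen_image_of_isLateChart (hlateO i)) (by
        rw [recutCharted_eq d M a Θ hmaps]
        exact subset_union_of_subset_right
          (subset_iUnion (fun i ↦ recutChart d M a Θ hmaps i '' (recutBackground d M a i).lateRegion τ₁) i) _)⟩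
  -- the flat chart, re-based at `τ₁`
  have hflatimg : d.toOver.flatChart '' (Minkowski.backgroundOn d.toOver.flatDomain).lateRegion τ₁ ⊆ O :=
    (image_mono ((Minkowski.backgroundOn d.toOver.flatDomain).lateRegion_mono hτ₀τ₁)).trans
      d.toOver.isLateChart_flat.image_subset
  have hflatO : 𝒟.toSpacetime.IsLateChart (Minkowski.backgroundOn d.toOver.flatDomain) O τ₁ d.toOver.flatChart :=
    isLateChart_rebase _ d.toOver.isLateChart_flat hτ₀τ₁ (isOpen_lateRegion_backgroundOn _ _) hflatimg
  have hflat : 𝒟.toSpacetime.IsLateChart (Minkowski.backgroundOn d.toOver.flatDomain)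
      (Summit.FinalStateConjecture.exteriorOf 𝒟.toCauchyDevelopment (recutCharted d M a Θ τ₁)) τ₁
      d.toOver.flatChart :=
    ⟨hflatO.contMDiff, hflatO.isOpenEmbedding,
      subset_exteriorOf_of_isOpen _ (hflatimg.trans hO.subset) (isOpen_image_of_isLateChart hflatO)
        subset_union_left⟩
  -- near-zone convergence for every radius, separation, excision
  have hconv' : ∀ i (R : ℝ), Tendsto (fun τ ↦ 𝒟.toSpacetime.truncDeviationCk (recutBackground d M a i)
      (recutChart d M a Θ hmaps i) 2 R τ) atTop (𝓝 0) := fun i ↦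
    tendsto_truncDeviationCk_of_tendsto_atTop _ _ _ (hR' i) (hconv i)
  have hsep := separation_recut d M a c r₀ Θ hmaps hsub hc hr₀ (fun i ↦ (hΘs i).continuousOn) hΘm hΘe
  obtain ⟨ρ, hρ, hρdom⟩ := excision_transfer 𝒟.toSpacetime O 2 d a
  -- the covering clause at `τ₁` from (ii)
  have hanti := exteriorOf_mono 𝒟.toCauchyDevelopment (recutCharted_anti d M a Θ hτ₀'τ₁.le)
  have hcov : Summit.FinalStateConjecture.exteriorOf 𝒟.toCauchyDevelopment (recutCharted d M a Θ τ₁) \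
      ((⋃ i, recutChart d M a Θ hmaps i '' (recutBackground d M a i).lateRegion τ₁) ∪
        d.toOver.flatChart '' (Minkowski.backgroundOn d.toOver.flatDomain).lateRegion τ₁) ⊆
      𝒟.metric.causalPast 𝒟.timeOrientation
        ((⋃ i, recutChart d M a Θ hmaps i '' (recutBackground d M a i).timeSlab τ₁) ∪
          d.toOver.flatChart '' (Minkowski.backgroundOn d.toOver.flatDomain).timeSlab τ₁) := fun p hp ↦
    LorentzianMetric.causalFuture_mono (recutCertifiedSlab_subset d M a Θ hmaps R' τ₁)
      (hii τ₁ hτ₀'τ₁ ⟨hanti hp.1, fun h ↦ hp.2 (recutCertifiedLate_subset d M a Θ hmaps R' τ₁ h)⟩)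
  -- buildfix 2026-08-20 (proof-only): since the audit-g6 re-type the summit's `HasExhaustiveCharts`
  -- asks for radii that GROW (`Tendsto (R i) atTop atTop`) and dominate `max r₊ 0 + 1`; enlarge the
  -- given growing radii `R'` to `R'' i τ := max (R' i τ) (max r₊ 0 + 1)`: eventually `R'' = R'`
  -- (so near-zone convergence is unchanged), and both certified sets only grow with the radii.
  have hfloor : ∀ i, ∀ᶠ τ in atTop, max (Kerr.rPlus (M i) (a i)) 0 + 1 ≤ R' i τ := fun i ↦
    (hR' i).eventually (eventually_ge_atTop _)
  have hconvR : ∀ i, Tendsto (fun τ ↦ 𝒟.toSpacetime.truncDeviationCk (recutBackground d M a i)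
      (fun y ↦ d.toOver.chart i ⟨recutMap (d.motion i).1 (d.motion i).2 (Θ i) y.1, hmaps i y.2⟩)
      2 (max (R' i τ) (max (Kerr.rPlus (M i) (a i)) 0 + 1)) τ) atTop (𝓝 0) := fun i ↦
    (hconv i).congr' ((hfloor i).mono fun τ hτ ↦ by simp only [max_eq_left hτ])
  have hLmono : ∀ τ₂, recutCertifiedLate d M a Θ R' τ₂ ⊆
      recutCertifiedLate d M a Θ (fun i τ ↦ max (R' i τ) (max (Kerr.rPlus (M i) (a i)) 0 + 1)) τ₂ :=
    fun τ₂ ↦ by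
    simp only [recutCertifiedLate_eq d M a Θ hmaps]
    exact union_subset_union le_rfl
      (iUnion_mono fun i ↦ image_mono fun x hx ↦ ⟨hx.1, hx.2.trans (le_max_left _ _)⟩)
  have hSmono : ∀ τ₂, recutCertifiedSlab d M a Θ R' τ₂ ⊆
      recutCertifiedSlab d M a Θ (fun i τ ↦ max (R' i τ) (max (Kerr.rPlus (M i) (a i)) 0 + 1)) τ₂ :=
    fun τ₂ ↦ by
    simp only [recutCertifiedSlab_eq d M a Θ hmaps]
    exact union_subset_union le_rfl
      (iUnion_mono fun i ↦ image_mono ((recutBackground d M a i).truncTimeSlab_mono (le_max_left _ _) τ₂))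
  refine ⟨_, recutDecomposition d M a Θ hmaps τ₁ (fun i ↦ (hsub i).pos) (fun i ↦ (hsub i).le) hlate hconv'
    hsep ρ hρ (hρdom τ₁ hτ₀τ₁) hflat hcov, hsub, ?_,
    fun i τ ↦ max (R' i τ) (max (Kerr.rPlus (M i) (a i)) 0 + 1),
    fun i ↦ ⟨tendsto_atTop_mono (fun τ ↦ le_max_left _ _) (hR' i), fun τ ↦ le_max_right _ _⟩,
    hconvR, fun τ₂ hτ₂ ↦ ?_⟩
  · rw [charted_recutDecomposition]
  · rw [certifiedLate_recutDecomposition, certifiedSlab_recutDecomposition]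
    exact fun p hp ↦ LorentzianMetric.causalFuture_mono (hSmono τ₂)
      (hii τ₂ (hτ₀'τ₁.trans hτ₂) ⟨hanti hp.1, fun h ↦ hp.2 (hLmono τ₂ h)⟩)

end Summit.FinalStateConjecture.FinalStateConjecture.Theorems.SymplecticDualOfTheBomb

end
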